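import Mathlib.MeasureTheory.Covering.Vitali
import Mathlib.MeasureTheory.Measure.Lebesgue.EqHaar
import Mathlib.MeasureTheory.Integral.Lebesgue.Countable
import HarnessLib

/-!
# Whitney-type families of balls with slowly varying radius (Tao 2011, §10, proof of Thm. 10.1)

Support file for the proof of the nonlinear estimate `Y₆` in Tao's enstrophy localisation
argument (T. Tao, *Localisation and compactness properties of the Navier–Stokes global regularity
problem*, arXiv:1108.1165, §10, pp. 32–33): "We apply a Whitney-type decomposition, covering `Ω`
by a boundedly overlapping collection of balls `Bᵢ = B(xᵢ, rᵢ)` with radius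
`rᵢ := (1/100) min(dist(xᵢ, ∂Ω), c^{0.1}δ^{-2})`. In particular, we have `η ∼ c^{-0.1}δ²rᵢ` on
`B(xᵢ, 10rᵢ)`."

We separate the covering geometry from the Navier–Stokes analysis.

* `IsWhitneyFamily r Ω S`: a countable set of centres `S ⊆ Ω` whose balls `B(x, r(x)/4)` are
  pairwise disjoint and whose balls `B(x, r(x))` cover `Ω`; `exists_isWhitneyFamily`: existence for
  any positive bounded radius function (Vitali's covering lemma,
  `Vitali.exists_disjoint_subfamily_covering_enlargement`, in a finite-dimensional space).
* `tsum_indicator_ball_le`: **bounded overlap** — if `r` is `L`-Lipschitz and `ML ≤ 1/2`, every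
  point lies in at most `(16M + 4)ⁿ` dilated balls `B(x, M r(x))` (volume packing against an
  additive Haar measure); `tsum_setLIntegral_ball_le`: the integrated form
  `Σₓ ∫_{B(x, M r(x))} f ≤ (16M+4)ⁿ ∫_{⋃ B(x, M r(x))} f`; `tsum_pow_radius_le`: the packing bound
  `Σ_{x ∈ S ∩ B(z, R), r(x) ≤ ρ} r(x)ⁿ ≤ (4R + ρ)ⁿ`; `setLIntegral_le_tsum_of_cover`:
  `∫_Ω f ≤ Σₓ ∫_{B(x, r(x))} f`.
* Tao's instance (the annulus of Remark 10.6 with its depth `d`, cutoff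
  `η = annularRamp k a b |· − x₀| = min(1, max(0, k d))` and radius
  `ρ = max(0, min(d, k⁻¹))/100`, `(1/100)`-Lipschitz, `η = 100kρ`) is the tree's
  `TaoWhitneyKernel.lean` (`annDepth`, `whitneyRadius`, `annularRamp_eq_mul_whitneyRadius`, the
  comparisons (10.20) on `B(y, cρ(y))`); the present file supplies the *discrete* boundedly
  overlapping subfamily that the parent-ball chaining of p. 33 needs ("for any small ball `Bᵢ`,
  we may assign a 'parent' ball `B_{p(i)}`"), which a continuous decomposition does not provide.

All statements are elementary ([folklore]); the constants are explicit but not optimised.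

## Mathlib search

Mathlib has Vitali's and Besicovitch's covering theorems (`Mathlib.MeasureTheory.Covering.*`) but
no Whitney decomposition; the tree has the *continuous* Whitney decomposition of the annulus
(`TaoWhitneyKernel.lean`: `annDepth`, `whitneyRadius`, `whitneyKernel`, Tonelli-based overlap
bounds) and Tao's cutoff (`annularRamp`/`movingCutoff`, `TaoMovingCutoff.lean`), but no discrete
boundedly overlapping family (`lean search 'IsWhitneyFamily|PairwiseDisjoint.*ball.*cover'`).

## References

* T. Tao, *Localisation and compactness properties of the Navier–Stokes global regularity
  problem*, Anal. PDE 6 (2013) 25–107 = arXiv:1108.1165 (`Tao2011`), §10, proof of Thm. 10.1,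
  p. 32 (the Whitney-type decomposition and (10.20)).
* E. M. Stein, *Singular integrals and differentiability properties of functions* (1970),
  Ch. VI §1 (Whitney decompositions).
-/

noncomputable section

open MeasureTheory Set Metric Filter
open scoped ENNReal NNReal Topology

namespace Literature.Analysis.FluidPDE

section Cover

variable {E : Type*} [NormedAddCommGroup E] [NormedSpace ℝ E]

/-- **A Whitney-type family of balls** for a radius function `r` on a region `Ω`: a countable set
of centres `S ⊆ Ω` such that the small balls `B(x, r(x)/4)`, `x ∈ S`, are pairwise disjoint and
the balls `B(x, r(x))` cover `Ω` (Tao 2011, §10: "a boundedly overlapping collection of balls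
`Bᵢ = B(xᵢ, rᵢ)`" covering `Ω`; bounded overlap of the dilates follows when `r` is slowly
varying, `tsum_indicator_ball_le`). [cite: Tao2011, §10, proof of Thm. 10.1 (Whitney decomposition)] -/
structure IsWhitneyFamily (r : E → ℝ) (Ω : Set E) (S : Set E) : Prop where
  /-- the centres lie in the region -/
  subset : S ⊆ Ω
  /-- there are countably many centres -/
  countable : S.Countable
  /-- the quarter balls are pairwise disjoint -/
  disjoint : S.PairwiseDisjoint fun x => ball x (r x / 4)
  /-- the balls cover the region -/
  cover : Ω ⊆ ⋃ x ∈ S, ball x (r x)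

/-- **Existence of Whitney-type families** for any radius function that is positive and bounded
on `Ω`, in a finite-dimensional real normed space: Vitali's covering lemma applied to the balls
`B(x, r(x)/4)`, `x ∈ Ω`, gives a disjoint subfamily such that every `B(a, r(a)/4)` meets some
`B(b, r(b)/4)` of the subfamily with `r(a) ≤ 2 r(b)`, whence `a ∈ B(b, r(b))`; disjoint open balls
in a separable space form a countable family. [folklore] -/
theorem exists_isWhitneyFamily [FiniteDimensional ℝ E] {r : E → ℝ} {Ω : Set E}
    (hpos : ∀ x ∈ Ω, 0 < r x) {R : ℝ} (hR : ∀ x ∈ Ω, r x ≤ R) :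
    ∃ S, IsWhitneyFamily r Ω S := by
  obtain ⟨u, huΩ, hdisj, hcov⟩ := Vitali.exists_disjoint_subfamily_covering_enlargement
    (fun x : E => ball x (r x / 4)) Ω (fun x => r x / 4) 2 one_lt_two
    (fun x hx => by linarith [hpos x hx]) (R / 4) (fun x hx => by linarith [hR x hx])
    (fun x hx => ⟨x, mem_ball_self (by linarith [hpos x hx])⟩)
  refine ⟨u, huΩ, ?_, hdisj, fun a ha => ?_⟩
  · exact hdisj.countable_of_isOpen (fun x _ => isOpen_ball)
      (fun x hx => ⟨x, mem_ball_self (by linarith [hpos x (huΩ hx)])⟩)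
  · obtain ⟨b, hb, ⟨z, hza, hzb⟩, hab⟩ := hcov a ha
    refine mem_iUnion₂.2 ⟨b, hb, ?_⟩
    rw [mem_ball] at hza hzb ⊢
    calc dist a b ≤ dist z a + dist z b := dist_triangle_left a b z
      _ < r a / 4 + r b / 4 := add_lt_add hza hzb
      _ ≤ r b := by linarith [hpos b (huΩ hb)]


omit [NormedSpace ℝ E] in
/-- Slowly varying radii are comparable on dilated balls: if `r` is `L`-Lipschitz, `M L ≤ 1/2`
and `y ∈ B(x, M r(x))`, then `r(x) ≤ 2 r(y)` and `r(y) ≤ (3/2) r(x)`. [folklore] -/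
theorem whitney_radius_compare {r : E → ℝ} {L : ℝ≥0} (hL : LipschitzWith L r) {M : ℝ} (hML : M * L ≤ 1 / 2)
    {x y : E} (hx : 0 < r x) (hy : y ∈ ball x (M * r x)) :
    r x ≤ 2 * r y ∧ r y ≤ 3 / 2 * r x := by
  have h1 : |r x - r y| ≤ L * dist x y := by
    have := hL.dist_le_mul x y
    rwa [Real.dist_eq] at this
  rw [mem_ball, dist_comm] at hy
  have hM : 0 ≤ M := by
    by_contra hM
    have : M * r x < 0 := mul_neg_of_neg_of_pos (not_le.1 hM) hx
    linarith [dist_nonneg (x := x) (y := y)]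
  have h2 : (L : ℝ) * dist x y ≤ L * (M * r x) :=
    mul_le_mul_of_nonneg_left hy.le L.coe_nonneg
  have h3 : (L : ℝ) * (M * r x) ≤ r x / 2 := by
    have : (L : ℝ) * M ≤ 1 / 2 := by rw [mul_comm]; exact hML
    nlinarith
  have h4 := abs_le.1 (h1.trans (h2.trans h3))
  constructor <;> linarith [h4.1, h4.2]

variable [FiniteDimensional ℝ E]

/-- **Bounded overlap of the dilated Whitney balls.** If the balls `B(x, r(x)/4)`, `x ∈ S`, are
pairwise disjoint, `r` is `L`-Lipschitz and positive on `S`, and `M L ≤ 1/2`, then every point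
lies in at most `(16M + 4)ⁿ` of the balls `B(x, M r(x))`, `n = dim E` (volume packing: the
disjoint balls `B(x, r(x)/4) ⊇ B(x, r(y)/8)` with `y ∈ B(x, M r(x))` all lie in
`B(y, (2M + 1/2) r(y))`). [folklore] -/
theorem tsum_indicator_ball_le [Nontrivial E] {r : E → ℝ} {L : ℝ≥0} (hL : LipschitzWith L r)
    {M : ℝ} (hM : 0 ≤ M) (hML : M * L ≤ 1 / 2) {S : Set E} (hS : S.Countable)
    (hdisj : S.PairwiseDisjoint fun x => ball x (r x / 4)) (hpos : ∀ x ∈ S, 0 < r x) (y : E) :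
    ∑' x : S, (ball (x : E) (M * r x)).indicator (fun _ => (1 : ℝ≥0∞)) y ≤
      ENNReal.ofReal ((16 * M + 4) ^ Module.finrank ℝ E) := by
  classical
  borelize E
  set μ : Measure E := Measure.addHaar
  set n := Module.finrank ℝ E with hn
  -- either `y` lies in no ball, or `r y > 0`
  by_cases hy : ∃ x ∈ S, y ∈ ball x (M * r x)
  swap
  · push Not at hy
    have : ∀ x : S, (ball (x : E) (M * r x)).indicator (fun _ => (1 : ℝ≥0∞)) y = 0 := fun x =>
      indicator_of_notMem (hy x x.2) _
    simp [this]
  obtain ⟨x₀, hx₀S, hyx₀⟩ := hy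
  have hry : 0 < r y := by
    have := (whitney_radius_compare hL hML (hpos x₀ hx₀S) hyx₀).1
    linarith [hpos x₀ hx₀S]
  -- the packing inequality
  set f : E → Set E := fun x => if y ∈ ball x (M * r x) then ball x (r x / 4) else ∅ with hf
  have hfsub : ∀ x, f x ⊆ ball x (r x / 4) := fun x => by
    simp only [hf]
    split_ifs
    · exact Subset.rfl
    · exact empty_subset _
  have hfdisj : S.PairwiseDisjoint f := hdisj.mono fun x => hfsub x
  have hfmeas : ∀ x ∈ S, MeasurableSet (f x) := fun x _ => by
    simp only [hf]
    split_ifs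
    · exact measurableSet_ball
    · exact MeasurableSet.empty
  have hU : (⋃ x ∈ S, f x) ⊆ ball y ((2 * M + 1 / 2) * r y) := by
    refine iUnion₂_subset fun x hxS => ?_
    simp only [hf]
    split_ifs with hyx
    · obtain ⟨h1, h2⟩ := whitney_radius_compare hL hML (hpos x hxS) hyx
      refine ball_subset_ball' ?_
      rw [mem_ball] at hyx
      rw [dist_comm] at hyx
      nlinarith
    · exact empty_subset _
  have key : ∑' x : S, μ (f x) ≤ μ (ball y ((2 * M + 1 / 2) * r y)) := by
    rw [← measure_biUnion hS hfdisj hfmeas]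
    exact measure_mono hU
  -- compare term by term with the indicator sum
  have hterm : ∀ x : S, (ball (x : E) (M * r x)).indicator (fun _ => (1 : ℝ≥0∞)) y *
      μ (ball (0 : E) (r y / 8)) ≤ μ (f x) := fun x => by
    simp only [hf, indicator_apply, mem_ball]
    split_ifs with hyx
    · rw [one_mul, ← Measure.addHaar_ball_center μ (x : E) (r y / 8)]
      refine measure_mono (ball_subset_ball ?_)
      have := (whitney_radius_compare hL hML (hpos x x.2) hyx).2
      linarith
    · simp
  have hsum : (∑' x : S, (ball (x : E) (M * r x)).indicator (fun _ => (1 : ℝ≥0∞)) y) *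
      μ (ball (0 : E) (r y / 8)) ≤ μ (ball y ((2 * M + 1 / 2) * r y)) := by
    rw [← ENNReal.tsum_mul_right]
    exact (ENNReal.tsum_le_tsum hterm).trans key
  -- volumes of balls
  have hvol1 : μ (ball (0 : E) (r y / 8)) = ENNReal.ofReal ((r y / 8) ^ n) * μ (ball 0 1) :=
    Measure.addHaar_ball μ 0 (by positivity)
  have hvol2 : μ (ball y ((2 * M + 1 / 2) * r y)) =
      ENNReal.ofReal ((16 * M + 4) ^ n) * (ENNReal.ofReal ((r y / 8) ^ n) * μ (ball 0 1)) := by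
    rw [Measure.addHaar_ball μ y (by positivity), ← mul_assoc, ← ENNReal.ofReal_mul (by positivity),
      ← mul_pow]
    congr 3
    ring
  rw [hvol1, hvol2] at hsum
  have h0 : ENNReal.ofReal ((r y / 8) ^ n) * μ (ball 0 1) ≠ 0 := by
    refine mul_ne_zero ?_ (measure_ball_pos μ 0 one_pos).ne'
    rw [Ne, ENNReal.ofReal_eq_zero, not_le]
    positivity
  have htop : ENNReal.ofReal ((r y / 8) ^ n) * μ (ball 0 1) ≠ ⊤ :=
    ENNReal.mul_ne_top ENNReal.ofReal_ne_top measure_ball_lt_top.ne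
  exact (ENNReal.mul_le_mul_iff_left h0 htop).mp hsum


/-- `f · 1_s = 1_s f` (pointwise). [folklore] -/
private theorem ennreal_mul_indicator_one_apply {α : Type*} (s : Set α) (f : α → ℝ≥0∞) (y : α) :
    f y * s.indicator (fun _ => (1 : ℝ≥0∞)) y = s.indicator f y := by
  by_cases h : y ∈ s <;> simp [h]

/-- **Bounded overlap, integrated form**: for `f ≥ 0`,
`Σ_{x ∈ S} ∫_{B(x, M r(x))} f ≤ (16M+4)ⁿ ∫_{⋃ B(x, M r(x))} f`. [folklore] -/
theorem tsum_setLIntegral_ball_le [Nontrivial E] [MeasurableSpace E] [BorelSpace E] (μ : Measure E)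
    {r : E → ℝ} {L : ℝ≥0} (hL : LipschitzWith L r)
    {M : ℝ} (hM : 0 ≤ M) (hML : M * L ≤ 1 / 2) {S : Set E} (hS : S.Countable)
    (hdisj : S.PairwiseDisjoint fun x => ball x (r x / 4)) (hpos : ∀ x ∈ S, 0 < r x)
    {f : E → ℝ≥0∞} (hf : AEMeasurable f μ) :
    ∑' x : S, ∫⁻ y in ball (x : E) (M * r x), f y ∂μ ≤
      ENNReal.ofReal ((16 * M + 4) ^ Module.finrank ℝ E) *
        ∫⁻ y in ⋃ x ∈ S, ball x (M * r x), f y ∂μ := by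
  classical
  haveI := hS.toEncodable
  set U : Set E := ⋃ x ∈ S, ball x (M * r x) with hU
  have hUm : MeasurableSet U := MeasurableSet.biUnion hS fun x _ => measurableSet_ball
  have hrepr : ∀ x : S, ∫⁻ y in ball (x : E) (M * r x), f y ∂μ =
      ∫⁻ y, f y * (ball (x : E) (M * r x)).indicator (fun _ => (1 : ℝ≥0∞)) y ∂μ := fun x => by
    rw [← lintegral_indicator measurableSet_ball]
    simp_rw [ennreal_mul_indicator_one_apply]
  have hmeas : ∀ x : S, AEMeasurable
      (fun y => f y * (ball (x : E) (M * r x)).indicator (fun _ => (1 : ℝ≥0∞)) y) μ := fun x =>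
    hf.mul (measurable_const.indicator measurableSet_ball).aemeasurable
  simp_rw [hrepr]
  rw [← lintegral_tsum hmeas]
  calc ∫⁻ y, ∑' x : S, f y * (ball (x : E) (M * r x)).indicator (fun _ => (1 : ℝ≥0∞)) y ∂μ
        = ∫⁻ y, f y * ∑' x : S, (ball (x : E) (M * r x)).indicator (fun _ => (1 : ℝ≥0∞)) y ∂μ := by
          congr 1; funext y; rw [ENNReal.tsum_mul_left]
      _ ≤ ∫⁻ y, f y *
          (U.indicator (fun _ => ENNReal.ofReal ((16 * M + 4) ^ Module.finrank ℝ E)) y) ∂μ := by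
          refine lintegral_mono fun y => mul_le_mul' le_rfl ?_
          by_cases hyU : y ∈ U
          · rw [indicator_of_mem hyU]
            exact tsum_indicator_ball_le hL hM hML hS hdisj hpos y
          · rw [indicator_of_notMem hyU]
            refine le_of_eq (ENNReal.tsum_eq_zero.2 fun x =>
              indicator_of_notMem (fun hyx => hyU ?_) _)
            exact mem_iUnion₂.2 ⟨x, x.2, hyx⟩
      _ = ENNReal.ofReal ((16 * M + 4) ^ Module.finrank ℝ E) * ∫⁻ y in U, f y ∂μ := by
          rw [← lintegral_indicator hUm, ← lintegral_const_mul'' _ (hf.indicator hUm)]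
          congr 1; funext y
          by_cases hyU : y ∈ U
          · rw [indicator_of_mem hyU, indicator_of_mem hyU, mul_comm]
          · rw [indicator_of_notMem hyU, indicator_of_notMem hyU, mul_zero, mul_zero]

/-- **Packing bound**: if the balls `B(x, r(x)/4)`, `x ∈ S`, are pairwise disjoint, then for every
centre `z`, radius `R` and cap `ρ ≥ 0`, `Σ_{x ∈ S, dist x z < R, r(x) ≤ ρ} r(x)ⁿ ≤ (4R + ρ)ⁿ`
(the disjoint balls lie in `B(z, R + ρ/4)`). [folklore] -/
theorem tsum_pow_radius_le [Nontrivial E] {r : E → ℝ} {S : Set E} (hS : S.Countable)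
    (hdisj : S.PairwiseDisjoint fun x => ball x (r x / 4)) (hpos : ∀ x ∈ S, 0 < r x)
    (z : E) {R ρ : ℝ} (hR : 0 ≤ R) (hρ : 0 ≤ ρ) :
    ∑' x : S, (if dist (x : E) z < R ∧ r x ≤ ρ then ENNReal.ofReal (r x ^ Module.finrank ℝ E) else 0) ≤
      ENNReal.ofReal ((4 * R + ρ) ^ Module.finrank ℝ E) := by
  classical
  borelize E
  set μ : Measure E := Measure.addHaar
  set n := Module.finrank ℝ E with hn
  set f : E → Set E := fun x => if dist x z < R ∧ r x ≤ ρ then ball x (r x / 4) else ∅ with hf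
  have hfsub : ∀ x, f x ⊆ ball x (r x / 4) := fun x => by
    simp only [hf]
    split_ifs
    · exact Subset.rfl
    · exact empty_subset _
  have hfdisj : S.PairwiseDisjoint f := hdisj.mono fun x => hfsub x
  have hfmeas : ∀ x ∈ S, MeasurableSet (f x) := fun x _ => by
    simp only [hf]
    split_ifs
    · exact measurableSet_ball
    · exact MeasurableSet.empty
  have hU : (⋃ x ∈ S, f x) ⊆ ball z (R + ρ / 4) := by
    refine iUnion₂_subset fun x hxS => ?_
    simp only [hf]
    split_ifs with hx
    · refine ball_subset_ball' ?_
      linarith [hx.1, hx.2]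
    · exact empty_subset _
  have key : ∑' x : S, μ (f x) ≤ μ (ball z (R + ρ / 4)) := by
    rw [← measure_biUnion hS hfdisj hfmeas]
    exact measure_mono hU
  have hterm : ∀ x : S, (if dist (x : E) z < R ∧ r x ≤ ρ then ENNReal.ofReal (r x ^ n) else 0) *
      (ENNReal.ofReal ((1 / 4 : ℝ) ^ n) * μ (ball (0 : E) 1)) = μ (f x) := fun x => by
    simp only [hf]
    split_ifs with hx
    · rw [Measure.addHaar_ball μ (x : E) (r := r x / 4) (by linarith [hpos x x.2]), ← mul_assoc,
        ← ENNReal.ofReal_mul (pow_nonneg (hpos x x.2).le n), ← mul_pow,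
        show r x * (1 / 4) = r x / 4 by ring]
    · simp
  have hsum : (∑' x : S, (if dist (x : E) z < R ∧ r x ≤ ρ then ENNReal.ofReal (r x ^ n) else 0)) *
      (ENNReal.ofReal ((1 / 4 : ℝ) ^ n) * μ (ball (0 : E) 1)) ≤ μ (ball z (R + ρ / 4)) := by
    rw [← ENNReal.tsum_mul_right]
    exact le_of_eq_of_le (tsum_congr hterm) key
  have hvol2 : μ (ball z (R + ρ / 4)) =
      ENNReal.ofReal ((4 * R + ρ) ^ n) * (ENNReal.ofReal ((1 / 4 : ℝ) ^ n) * μ (ball 0 1)) := by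
    rw [Measure.addHaar_ball μ z (by positivity), ← mul_assoc, ← ENNReal.ofReal_mul (by positivity),
      ← mul_pow]
    congr 3
    ring
  rw [hvol2] at hsum
  have h0 : ENNReal.ofReal ((1 / 4 : ℝ) ^ n) * μ (ball 0 1) ≠ 0 := by
    refine mul_ne_zero ?_ (measure_ball_pos μ 0 one_pos).ne'
    rw [Ne, ENNReal.ofReal_eq_zero, not_le]
    positivity
  have htop : ENNReal.ofReal ((1 / 4 : ℝ) ^ n) * μ (ball 0 1) ≠ ⊤ :=
    ENNReal.mul_ne_top ENNReal.ofReal_ne_top measure_ball_lt_top.ne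
  exact (ENNReal.mul_le_mul_iff_left h0 htop).mp hsum

omit [NormedSpace ℝ E] [FiniteDimensional ℝ E] in
/-- **Covering, integrated form**: `∫_Ω f ≤ Σ_{x ∈ S} ∫_{B(x, r(x))} f` for `f ≥ 0`. [folklore] -/
theorem setLIntegral_le_tsum_of_cover [MeasurableSpace E] (μ : Measure E) {r : E → ℝ} {Ω S : Set E}
    (hS : S.Countable) (hcover : Ω ⊆ ⋃ x ∈ S, ball x (r x)) (f : E → ℝ≥0∞) :
    ∫⁻ y in Ω, f y ∂μ ≤ ∑' x : S, ∫⁻ y in ball (x : E) (r x), f y ∂μ := by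
  haveI := hS.toEncodable
  calc ∫⁻ y in Ω, f y ∂μ ≤ ∫⁻ y in ⋃ x ∈ S, ball x (r x), f y ∂μ := lintegral_mono_set hcover
    _ = ∫⁻ y in ⋃ x : S, ball (x : E) (r x), f y ∂μ := by rw [biUnion_eq_iUnion]
    _ ≤ ∑' x : S, ∫⁻ y in ball (x : E) (r x), f y ∂μ := lintegral_iUnion_le _ _

end Cover



end Literature.Analysis.FluidPDE

end
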